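import Summits.Parity.GeneralizedHardyLittlewood.Theorems.LeeYangFibresRelativeDimOneMoebiusSplitDefs
import Literature.NumberTheory.Sieve.LinearEquationsInPrimesDimOne
import HarnessLib

/-!
# Route `LeeYangFibres`, crux `RelativeDimOne` (stmt-Parity-14113), line `single-moebius-split`:
# helper file 5 for the stub `stub_moebiusTermBV` — the pure-Möbius term as a sum over sieve tuples

`moebiusTermSum_expand`: for a `d = 1` system `Ψ = (ψ₀, …, ψ_k)`, a convex `K ⊆ [-N, N]` and levels
`R_i ≥ 0`,
`∑_{n ∈ K ∩ ℤ} (Λ − Λ_{R_0})(ψ₀(n)) ∏_{i ≥ 1} Λ_{R_i}(ψ_i(n)) = ∑_{t} w(t) ∑_{m ∈ [m₁, m₂], t_i ∣ ψ_i(m) (i ≥ 1)} (Λ − Λ_{R_0})(ψ₀(m))`,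
where `[m₁, m₂] ⊆ [-N, N]` is the integer interval on which all forms are positive (the summand
vanishes elsewhere: `Λ`, `Λ_R` vanish at non-positive arguments; the positivity region of a convex
slice is an interval, tree `DimOne.exists_filter_eq_Icc`), `t = (t_i)_{i ≥ 1}` runs over
`∏_{i ≥ 1} [1, R_i]` and `w(t) = ∏_{i ≥ 1} μ(t_i) log(R_i/t_i)` (expanding each truncated divisor sum
`Λ_{R_i}(v) = ∑_{d ∣ v, d ≤ R_i} μ(d) log(R_i/d)`).

References: D. A. Goldston, C. Y. Yıldırım, Integers 3 (2003) A5 [GoldstonYildirim2001]; B. Green,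
T. Tao, Ann. of Math. 171 (2010), §1 and App. D [GreenTao2010].
-/

noncomputable section

open scoped BigOperators Classical
open Finset Literature.NumberTheory.Sieve
open scoped ArithmeticFunction.Moebius

namespace Summit.Parity.GeneralizedHardyLittlewood.Cruxes.RelativeDimOne.SingleMoebiusSplit

/-! ### Sums over the box `[-N, N]¹` -/

/-- Sums over the lattice points of the box `[-N, N]¹` with real point in `K` are sums over the
integers `m ∈ [-N, N]` with `(m) ∈ K` (`n ↦ n₀`). [folklore] -/
theorem sum_filter_latticeBox_eq (N : ℕ) (K : Set (Fin 1 → ℝ)) (F : (Fin 1 → ℤ) → ℝ) :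
    ∑ n ∈ (latticeBox 1 N).filter (fun n => realPoint n ∈ K), F n =
      ∑ m ∈ (Finset.Icc (-(N : ℤ)) N).filter (fun m : ℤ => (fun _ : Fin 1 => (m : ℝ)) ∈ K),
        F (fun _ => m) := by
  -- adapted from `Literature.NumberTheory.Sieve.DimOne.card_filter_latticeBox`
  refine Finset.sum_nbij' (fun n => n 0) (fun m _ => m) (fun n hn => ?_) (fun m hm => ?_)
    (fun n _ => ?_) (fun m _ => rfl) (fun n _ => ?_)
  · rw [Finset.mem_filter] at hn ⊢
    have h1 : n = fun _ => n 0 := by funext i; rw [Fin.fin_one_eq_zero i]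
    refine ⟨Fintype.mem_piFinset.mp hn.1 0, ?_⟩
    have h2 := hn.2
    rw [h1] at h2
    exact h2
  · rw [Finset.mem_filter] at hm ⊢
    exact ⟨Fintype.mem_piFinset.mpr fun _ => hm.1, hm.2⟩
  · funext i; simp [Fin.fin_one_eq_zero i]
  · congr 1; funext i; simp [Fin.fin_one_eq_zero i]

/-! ### The truncated divisor sum as a sum over `[1, R]` -/

/-- `Λ_R(v) = ∑_{1 ≤ d ≤ R, d ∣ v} μ(d) log(R/d)` for an integer `v ≥ 1`. [folklore] -/
theorem lambdaR_eq_sum_Icc_of_pos {R : ℝ} (hR : 0 ≤ R) {v : ℤ} (hv : 1 ≤ v) :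
    lambdaR R v = ∑ d ∈ Finset.Icc 1 ⌊R⌋₊, if (d : ℤ) ∣ v then (μ d : ℝ) * Real.log (R / d) else 0 := by
  unfold lambdaR
  rw [← Finset.sum_filter]
  have hv0 : v.toNat ≠ 0 := by
    intro h; rw [Int.toNat_eq_zero] at h; omega
  have hvv : ((v.toNat : ℕ) : ℤ) = v := Int.toNat_of_nonneg (by omega)
  refine Finset.sum_congr ?_ fun d _ => rfl
  ext d
  simp only [Finset.mem_filter, Nat.mem_divisors, Finset.mem_Icc]
  have hdvd : d ∣ v.toNat ↔ (d : ℤ) ∣ v := by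
    rw [← Int.natCast_dvd_natCast, hvv]
  constructor
  · rintro ⟨⟨hdv, -⟩, hdR⟩
    exact ⟨⟨Nat.pos_of_dvd_of_pos hdv (Nat.pos_of_ne_zero hv0), Nat.le_floor hdR⟩, hdvd.1 hdv⟩
  · rintro ⟨⟨-, hdR⟩, hdv⟩
    exact ⟨⟨hdvd.2 hdv, hv0⟩, le_trans (by exact_mod_cast hdR) (Nat.floor_le hR)⟩

/-- Expanding a product of truncated divisor sums over tuples: for integers `v_i ≥ 1`,
`∏_i Λ_{R_i}(v_i) = ∑_{t ∈ ∏_i [1, R_i]} [t_i ∣ v_i ∀ i] ∏_i μ(t_i) log(R_i/t_i)`. [folklore] -/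
theorem prod_lambdaR_eq_sum_piFinset {k : ℕ} (R : Fin k → ℝ) (hR : ∀ i, 0 ≤ R i) (v : Fin k → ℤ)
    (hv : ∀ i, 1 ≤ v i) :
    ∏ i, lambdaR (R i) (v i) =
      ∑ t ∈ Fintype.piFinset (fun i => Finset.Icc 1 ⌊R i⌋₊),
        if ∀ i, ((t i : ℕ) : ℤ) ∣ v i then ∏ i, (μ (t i) : ℝ) * Real.log (R i / t i) else 0 := by
  have h1 : ∏ i, lambdaR (R i) (v i) =
      ∏ i, ∑ d ∈ Finset.Icc 1 ⌊R i⌋₊,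
        (if (d : ℤ) ∣ v i then (μ d : ℝ) * Real.log (R i / d) else 0) :=
    Finset.prod_congr rfl fun i _ => lambdaR_eq_sum_Icc_of_pos (hR i) (hv i)
  rw [h1, Finset.prod_univ_sum]
  refine Finset.sum_congr rfl fun t _ => ?_
  rw [Finset.prod_ite_zero]
  simp only [Finset.mem_univ, forall_true_left]

/-! ### The expansion -/

/-- **The pure-Möbius term as a sum over sieve tuples.** For a `d = 1` system `Ψ = (ψ₀, …, ψ_k)`, a
convex `K ⊆ [-N, N]` and levels `R_i ≥ 0` there is an integer interval `[m₁, m₂] ⊆ [-N, N]` on which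
every form is `≥ 1` such that
`moebiusTermSum Ψ K N R = ∑_t w(t) ∑_{m ∈ [m₁, m₂], t_i ∣ ψ_i(m) ∀ i ≥ 1} (Λ(ψ₀(m)) − Λ_{R_0}(ψ₀(m)))`,
`t ∈ ∏_{i ≥ 1} [1, R_i]`, `w(t) = ∏_{i ≥ 1} μ(t_i) log(R_i/t_i)` (the summand vanishes off the
positivity region, which meets `ℤ` in an interval by convexity; then expand the truncated factors).
[cite: GoldstonYildirim2001, §"mixed correlations"] -/
theorem moebiusTermSum_expand : ∀ (k N : ℕ) (Ψ : Fin (k + 1) → AffLinForm 1) (K : Set (Fin 1 → ℝ)) (R : Fin (k + 1) → ℝ), Convex ℝ K → K ⊆ realBox 1 N → (∀ i, 0 ≤ R i) → ∃ m₁ m₂ : ℤ, -(N : ℤ) ≤ m₁ ∧ m₂ ≤ N ∧ (∀ m ∈ Finset.Icc m₁ m₂, ∀ i, 1 ≤ (Ψ i).eval (fun _ => m)) ∧ moebiusTermSum Ψ K N R = ∑ t ∈ Fintype.piFinset (fun i : Fin k => Finset.Icc 1 ⌊R i.succ⌋₊), (∏ i, ((ArithmeticFunction.moebius (t i) : ℤ)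 : ℝ) * Real.log (R i.succ / t i)) * ∑ m ∈ (Finset.Icc m₁ m₂).filter (fun m => ∀ i, ((t i : ℕ) : ℤ) ∣ (Ψ i.succ).eval (fun _ => m)), (intVonMangoldt ((Ψ 0).eval fun _ => m) - lambdaR (R 0) ((Ψ 0).eval fun _ => m)) := by
  intro k N Ψ K R hK hKN hR
  -- the positivity region of the slice and its integer points
  set S : Set ℝ := {r : ℝ | (fun _ : Fin 1 => r) ∈ K ∧ ∀ i, 0 < (Ψ i).realEval (fun _ => r)} with hS
  have hSconv : Convex ℝ S := by
    have h1 : S = {r : ℝ | (fun _ : Fin 1 => r) ∈ K} ∩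
        ⋂ i, {r : ℝ | 0 < ((Ψ i).coeff 0 : ℝ) * r + (Ψ i).const} := by
      ext r
      simp only [hS, Set.mem_setOf_eq, Set.mem_inter_iff, Set.mem_iInter, DimOne.realEval_eq]
    rw [h1]
    exact (DimOne.convex_slice hK).inter (convex_iInter fun i => DimOne.convex_setOf_pos _ _)
  have hSN : S ⊆ Set.Icc (-(N : ℝ)) N := by
    intro r hr
    have h := hKN hr.1
    simp only [realBox, Set.mem_Icc] at h
    exact ⟨h.1 0, h.2 0⟩
  obtain ⟨m₁, m₂, hI, -⟩ := DimOne.exists_filter_eq_Icc (N := N) hSconv.ordConnected hSN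
  -- the summand and its vanishing off the positivity region
  set F : ℤ → ℝ := fun m => (intVonMangoldt ((Ψ 0).eval fun _ => m) - lambdaR (R 0) ((Ψ 0).eval fun _ => m)) *
    ∏ i : Fin k, lambdaR (R i.succ) ((Ψ i.succ).eval fun _ => m) with hF
  have hreal : ∀ (m : ℤ) (i : Fin (k + 1)),
      (Ψ i).realEval (fun _ : Fin 1 => (m : ℝ)) = (((Ψ i).eval fun _ => m : ℤ) : ℝ) := by
    intro m i
    exact AffLinForm.realEval_intCast (Ψ i) (fun _ => m)
  have hvanish : ∀ m : ℤ, F m ≠ 0 → ∀ i, 0 < (Ψ i).realEval (fun _ : Fin 1 => (m : ℝ)) := by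
    intro m hm i
    rw [hreal]
    by_contra hle
    push Not at hle
    have hle' : (Ψ i).eval (fun _ => m) ≤ 0 := by exact_mod_cast hle
    apply hm
    rw [hF]
    dsimp only
    rcases Fin.eq_zero_or_eq_succ i with h0 | ⟨j, hj⟩
    · subst h0
      have h1 : intVonMangoldt ((Ψ 0).eval fun _ => m) = 0 := by
        unfold intVonMangoldt
        rw [Int.toNat_eq_zero.mpr hle']
        simp
      rw [h1, lambdaR_nonpos _ hle', sub_zero, zero_mul]
    · subst hj
      rw [Finset.prod_eq_zero (Finset.mem_univ j) (lambdaR_nonpos _ hle'), mul_zero]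
  -- positivity on `[m₁, m₂]`
  have hpos : ∀ m ∈ Finset.Icc m₁ m₂, ∀ i, 1 ≤ (Ψ i).eval (fun _ => m) := by
    intro m hm i
    rw [← hI, Finset.mem_filter] at hm
    have h := hm.2.2 i
    rw [hreal] at h
    have : 0 < (Ψ i).eval (fun _ => m) := by exact_mod_cast h
    omega
  -- the sum restricted to `[m₁, m₂]`
  have hfilt : (Finset.Icc (-(N : ℤ)) N).filter (fun m : ℤ => ((m : ℤ) : ℝ) ∈ S) =
      ((Finset.Icc (-(N : ℤ)) N).filter (fun m : ℤ => (fun _ : Fin 1 => (m : ℝ)) ∈ K)).filter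
        (fun m : ℤ => ∀ i, 0 < (Ψ i).realEval (fun _ : Fin 1 => (m : ℝ))) := by
    ext m
    simp only [hS, Finset.mem_filter, Set.mem_setOf_eq, and_assoc]
  have hsum : moebiusTermSum Ψ K N R = ∑ m ∈ Finset.Icc m₁ m₂, F m := by
    unfold moebiusTermSum
    rw [sum_filter_latticeBox_eq, ← hI, hfilt, Finset.sum_filter_of_ne (fun m _ hm => hvanish m hm)]
  -- normalise the interval to lie in `[-N, N]`
  have hIsub : Finset.Icc m₁ m₂ ⊆ Finset.Icc (-(N : ℤ)) N := by
    rw [← hI]; exact Finset.filter_subset _ _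
  by_cases hle : m₁ ≤ m₂
  · have hm₁ : m₁ ∈ Finset.Icc (-(N : ℤ)) N := hIsub (Finset.left_mem_Icc.2 hle)
    have hm₂ : m₂ ∈ Finset.Icc (-(N : ℤ)) N := hIsub (Finset.right_mem_Icc.2 hle)
    refine ⟨m₁, m₂, (Finset.mem_Icc.1 hm₁).1, (Finset.mem_Icc.1 hm₂).2, hpos, ?_⟩
    rw [hsum]
    -- expand the truncated factors over tuples and swap the sums
    calc ∑ m ∈ Finset.Icc m₁ m₂, F m
        = ∑ m ∈ Finset.Icc m₁ m₂, ∑ t ∈ Fintype.piFinset (fun i : Fin k => Finset.Icc 1 ⌊R i.succ⌋₊),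
            (if ∀ i, ((t i : ℕ) : ℤ) ∣ (Ψ i.succ).eval (fun _ => m) then
              (intVonMangoldt ((Ψ 0).eval fun _ => m) - lambdaR (R 0) ((Ψ 0).eval fun _ => m)) *
                ∏ i, (μ (t i) : ℝ) * Real.log (R i.succ / t i) else 0) := by
          refine Finset.sum_congr rfl fun m hm => ?_
          rw [hF]
          dsimp only
          rw [prod_lambdaR_eq_sum_piFinset (fun i : Fin k => R i.succ) (fun i => hR i.succ)
            (fun i => (Ψ i.succ).eval fun _ => m) (fun i => hpos m hm i.succ), Finset.mul_sum]
          refine Finset.sum_congr rfl fun t _ => ?_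
          rw [mul_ite, mul_zero]
      _ = ∑ t ∈ Fintype.piFinset (fun i : Fin k => Finset.Icc 1 ⌊R i.succ⌋₊), ∑ m ∈ Finset.Icc m₁ m₂,
            (if ∀ i, ((t i : ℕ) : ℤ) ∣ (Ψ i.succ).eval (fun _ => m) then
              (intVonMangoldt ((Ψ 0).eval fun _ => m) - lambdaR (R 0) ((Ψ 0).eval fun _ => m)) *
                ∏ i, (μ (t i) : ℝ) * Real.log (R i.succ / t i) else 0) := Finset.sum_comm
      _ = _ := by
          refine Finset.sum_congr rfl fun t _ => ?_
          rw [← Finset.sum_filter, Finset.mul_sum]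
          refine Finset.sum_congr rfl fun m _ => ?_
          ring
  · -- empty positivity region: both sides vanish
    refine ⟨1, 0, by omega, by omega, fun m hm => ?_, ?_⟩
    · rw [Finset.mem_Icc] at hm; omega
    · rw [hsum, Finset.Icc_eq_empty_of_lt (by omega), Finset.sum_empty,
        Finset.Icc_eq_empty_of_lt (by norm_num)]
      simp

end Summit.Parity.GeneralizedHardyLittlewood.Cruxes.RelativeDimOne.SingleMoebiusSplit
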